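import Summits.AtomisticToContinuum.FouriersLaw.Theorems.BondHeatUncertaintyBoundedResponseTransientBandB
import Summits.AtomisticToContinuum.FouriersLaw.Theses.OddSectorIrreversibility
import Summits.AtomisticToContinuum.FouriersLaw.Theorems.OddSectorIrreversibilityCorrectorTheoryUniformMixing

/-!
# BoundedResponse (stmt-AtomisticToContinuum-11071) — the PARITY FLOOR: the snapshot irreversibility (K) bounds the
retarded transient from below, so `(D) ∧ (K) ∧ two fixed-N lemmas ⟹ 11071`

Cell `decomp-a2c`, lineage `decomp-a2c-lens-1` (lens «grading / quantitative ladder»), generation 94 — node beneath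
the transient piece `(F₁) TransientFloor 1` of the generation-92 door of record
`boundedResponse_of_deficitCesaroPoint_transientFloor : (D) → (F₁) → BoundedResponse`
(`Theorems/BondHeatUncertaintyBoundedResponseTransientBandB.lean`).  Sorry-free; Props and real-inequality
bookkeeping over the tree's objects; no literature facts, no instances, no notation.  Route context:
`Theses/BondHeatUncertainty.lean` (route-AtomisticToContinuum-BondHeatUncertainty, DORMANT).

## Thesis of the node (one identity, one inequality)

Fix `N ≥ 2`, `T > 0`, the equilibrium semigroup `P_u` of the pinned anharmonic chain (`transitionKernel N T T u`,
self-dual up to momentum reversal `Θ`: `⟨f, P_u g⟩ = ⟨Θg, P_u Θf⟩` in `L²(μ_T)` — the tree's `pinnedChain_detailedBalance`),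
`θ₀ := p₀² − T`, `K_N(u) := ⟨θ₀, P_u θ₀⟩` (`escapeKernel`), and the `θ₀`-corrector `h₀ := ∫₀^∞ P_u θ₀ du ∈ L²(μ_T)`
(exponential ergodicity, as in the tree's `CorrectorTheory`).  Then for every `t ≥ 0`

  (I)  `(T²/γ)·escapeTransient_N(t) = ∫₀^∞ min(u,t) K_N(u) du = ⟨h₀∘Θ, h₀ − P_t h₀⟩_{L²(μ_T)}`

(`∫₀^∞ min(u,t) P_u θ₀ du = ∫₀^t P_s h₀ ds`, then move `P_s` across with the `Θ`-duality, `θ₀` even), and since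
`‖P_t h₀‖ ≤ ‖h₀‖` (contraction) and `⟨h₀∘Θ, h₀⟩ = ‖h₀^even‖² − ‖h₀^odd‖²`,

  (II) `−(2γ/T²)·‖h₀^odd‖² ≤ escapeTransient_N(t) ≤ (2γ/T²)·‖h₀^even‖²`   for ALL `t ≥ 0`.

The odd part of `h₀` is a KNOWN object of the summit: by the site-`0` energy balance `L e₀ = −j₀ − γθ₀` and bond
telescoping (`u_i − u_{i+1}` even), `h₀^odd = −γ⁻¹ u₀^odd = −u_tot^odd/(γ(N−1))` (`u_tot` = the total-current Kubo corrector),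
and by the tree's PROVED `OddSectorIrreversibility.OddDensityIsCorrector` the odd part of the NESS linear-response density
`h` (`dμ_{N,T+δ/2,T−δ/2} = (1 + δh + o(δ)) dμ_T`, the tree's PROVED `ResponseDensity`) is `h − h∘Θ = (u_tot − u_tot∘Θ)/((N−1)T²)`.
Hence `‖h₀^odd‖² = (T⁴/(4γ²))·∫ (h − h∘Θ)² dμ_T` and (II, lower) reads

  (L)  `escapeTransient_N(t) ≥ −(T²/(2γ)) · ∫ (h − h∘Θ)² dμ_{N,T,T}`   for all `t ≥ 0`      — `OvershootParityFloor` below.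

The right-hand side is the `L²`-core of the route's crux (K) = `ExtensiveSnapshotIrreversibility` (stmt-9121):
`KL(μ_δ ‖ Θ_*μ_δ) = (δ²/2)·∫ (h − h∘Θ)² dμ_T + o(δ²)`, so (K)'s `KL ≤ C·N·δ²` gives `∫ (h − h∘Θ)² dμ_T ≤ 2C·N`
(`SnapshotKLLowerExpansion`, the fixed-`N` lower Donsker–Varadhan expansion, is the only analytic input), whence
`escapeTransient_N(t) ≥ −(T²C/γ)·N` uniformly in `t` — i.e. `TransientFloor 1` for EVERY window `c` — and with (D) the
generation-92 door closes 11071 BY NAME (`boundedResponse_of_deficitCesaroPoint_snapshot`).  Dictionary (harmonic calibration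
below): `K_N := lim 2δ⁻²·KL = ½∫(h − h∘Θ)² = (2γ²/T⁴)‖h₀^odd‖²`.

So the door of record becomes   **11071 ⟸ (D) DeficitCesaroPoint ∧ (K) 9121 ∧ (L) ∧ (L₂)**,   (L), (L₂) fixed-`N`:
the transient piece (F₁) LEAVES the lineage's residual list — it is discharged by the crux (K) that the route already staffs
(and for which this lineage built the `K_fix`/energy-window attack tree, generations 69–90).  Generation 92's header said
"(K) does not enter this junction"; (I)–(II) show it enters LINEARLY (a floor of the retarded transient by the odd sector of
the response density), not through the TUR used by the route's `closes` (`D² ≤ V̄·K/2`, quadratic, needs the variance (S)).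
In particular (S) `SubdiffusiveBondHeat` (stmt-9120) is replaced by (D) on this door.

## Pieces (tags per doctrine D-0171; TARGET of the node = (F₁), hence 11071 via generation 92)

| piece | statement | tag |
|---|---|---|
| (L)  `OvershootParityFloor` | fixed `N ≥ 2`, `∀ t ≥ 0`: `Ov_N(t) ≥ −(T²/(2γ))∫(h−h∘Θ)²dμ_T` for every response density `h` | fixed-N · ATTACKABLE·M · proof = (I)+(II) from four tree facts (`pinnedChain_detailedBalance`, contraction `pinnedChain_sq_act_le_of_sq_integrable`, `CorrectorTheory`-type existence of `h₀`, `OddDensityIsCorrector`) · numerically CERTIFIED on the exactly solvable member (below) |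
| (L₂) `SnapshotKLLowerExpansion` | fixed `N`: `KL(μ_δ‖Θ_*μ_δ) ≤ B·δ²` eventually ⟹ `½∫(h−h∘Θ)²dμ_T ≤ B` | fixed-N · ATTACKABLE·S/M · Donsker–Varadhan with the bounded truncations of `δ·(h−h∘Θ)` as test functions + `tendsto_oddAsymmetry` (tree) |
| (O_s) `OddSnapshotGrade s` | `∫(h−h∘Θ)²dμ_{N,T,T} ≤ C·N^s` eventually in `N` | graded, larger `s` = WEAKER: `s = 1` ⟸ (K) ∧ (L₂) (PROVED here) · phonon-TRUE (`= 0.32·N` exactly at `ω₂=γ=T=1`) · NOT implied by 11071 (independent of it; a sufficient condition for (F₁) given (L)); `s = 0` = the «intensive arrow» of route OddSectorIrreversibility (phonon-FALSE, deterministic-diffusive plausible: the OddResponseBound disprover measured `≍ N⁰` at `(1,1,0.1,1), T = 8`); `s = −1` ⟺ the conclusion of `OddResponseBound` (stmt-9140; dead: `Theorems/OddResponseBound/Negative/EchoFloor.lean`) |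
| (D) `DeficitCesaroPoint` | `W_N(cN²) ≤ C·N` | unchanged residual of generation 92 (WEAKER than 11071, `N_F`-side) |

Doors PROVED in this file: `(L) ∧ (O_s) ⟹ TransientFloorUniform s ⟹ TransientFloor s` (every `s`, every window `c`);
`(L₂) ∧ (K) ⟹ (O₁)`; `(D) ∧ (L) ∧ (L₂) ∧ (K) ⟹ BoundedResponse`; the graded ladder `(L) ∧ (O_s) ∧ (D_h) ⟹ ExponentFloor (2 − max s h)`;
the pointwise budget `t·E_N ≤ W_N(t) + (T²/(2γ))∫(h−h∘Θ)²dμ_T` (every `t ≥ 0`); `OddResponseBound ⟹ (O₋₁)` (the dead bottom rung).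
The weak-NESS uniqueness and the existence of response densities that the frames of (K)/(L)/(O_s) presuppose are DISCHARGED by the
tree's proved `BondHeatUncertainty.NessUnique` (`bondHeatUncertainty_nessUnique_holds`) and `OddSectorIrreversibility.ResponseDensity`
(`responseDensity_holds`).

## Harmonic calibration (exact Gaussian computation, pure python, cell folder `decomp-a2c-lens-1/g94/num/`)

`ω₂ = γ = T = 1`, `lam = β = 0` (the exactly solvable member; outside the pinned-anharmonic class, used only to certify the
algebra): identity (I) holds to `≤ 1.6e−15` for `N = 1..6`, `t ∈ {0.5,…,64}`; the floor (L) computed from the NESS response density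
(`∫(h−h∘Θ)²dμ_T = 0.4444, 0.6777, 0.9389, 1.2404, 1.5617` for `N = 2..6`, i.e. `≈ 0.32·N`) coincides with `(2γ/T²)‖h₀^odd‖²` to ratio
`1.000000` (also at `(ω₂,γ,T) = (2, 0.5, 3)`); `min_t ∫₀^∞min(u,t)K_N = +0.167 ≥ −0.781` (`N = 6`); `E_N(Green–Kubo) = E_N(NESS)` to 6 digits.
So for phonons (O₁) holds with `C ≈ 0.32`, (F₁) holds, and 11071 fails only through (D) (`W_N ≍ N²`): the door is not vacuous and
each `N`-uniform piece is compatible with the ballistic class, hence strictly weaker than 11071.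
-/

noncomputable section

open MeasureTheory Filter Topology Set
open Literature.MathematicalPhysics.KineticTheory.HeatConduction

namespace Summit.AtomisticToContinuum.FouriersLaw.Theorems.BoundedResponse.ParityFloor

open Summit.AtomisticToContinuum.FouriersLaw.Theses.BondHeatUncertainty
  (BoundedResponse ExtensiveSnapshotIrreversibility NessUnique)
open Summit.AtomisticToContinuum.FouriersLaw.Theses.OddSectorIrreversibility (ResponseDensity OddResponseBound)
open Summit.AtomisticToContinuum.FouriersLaw.Theorems.SubdiffusiveBondHeat (bondHeatUncertainty_nessUnique_holds)
open Summit.AtomisticToContinuum.FouriersLaw.Theorems.SubdiffusiveBondHeat.EscapeGrading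
  (escapeDeficit OhmicFloor ExponentFloor)
open Summit.AtomisticToContinuum.FouriersLaw.Theorems.BoundedResponse.TransientBand
  (deficitCesaro escapeTransient DeficitCesaroPoint TransientFloor DeficitCesaroGrade deficitCesaro_eq_add
    boundedResponse_of_deficitCesaroPoint_transientFloor ohmicFloor_of_deficitCesaroPoint_transientFloor
    exponentFloor_of_grades)
open Summit.AtomisticToContinuum.FouriersLaw.Theorems.OddSectorIrreversibility.Corrector (responseDensity_holds)

/-! ## §1 The frame: uniqueness, steady-state families, response densities, the odd defect -/

/-- Weak-steady-state uniqueness of the pinned chain at one parameter point — VERBATIM the uniqueness antecedent of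
`ExtensiveSnapshotIrreversibility` (stmt-9121) / `ResponseDensity` (stmt-9144); an instance of the tree's proved
`BondHeatUncertainty.NessUnique` (`uniqueNESS_of_nessUnique`). (frame) [route frame · this cell] -/
def UniqueNESS (ω₂ lam β γ : ℝ) : Prop :=
  ∀ (N : ℕ) (T_L T_R : ℝ), 0 < T_L → 0 < T_R → ∀ μ ν : Measure (PhaseSpace N),
    (pinnedChain ω₂ lam β γ).IsSteadyState N T_L T_R μ → (pinnedChain ω₂ lam β γ).IsSteadyState N T_L T_R ν → μ = ν

/-- A steady-state family `μ_{N,T_L,T_R}` — VERBATIM the family antecedent of stmt-9121 / stmt-9144. (frame) [route frame · this cell] -/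
def IsSteadyFamily (ω₂ lam β γ : ℝ) (μ : (N : ℕ) → ℝ → ℝ → Measure (PhaseSpace N)) : Prop :=
  ∀ (N : ℕ) (T_L T_R : ℝ), 0 < T_L → 0 < T_R → (pinnedChain ω₂ lam β γ).IsSteadyState N T_L T_R (μ N T_L T_R)

/-- `h` is an `L²` linear-response density of the family at `(N, T)` along the antisymmetric direction
`δ ↦ μ_{N,T+δ/2,T−δ/2}` — VERBATIM the bracket of `OddSectorIrreversibility.ResponseDensity` / `OddResponseBound`
(pairings against smooth compactly supported observables and against the bond currents). (frame) [route frame · this cell] -/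
def IsResponseDensity (ω₂ lam β γ : ℝ) (μ : (N : ℕ) → ℝ → ℝ → Measure (PhaseSpace N)) (T : ℝ) (N : ℕ)
    (h : PhaseSpace N → ℝ) : Prop :=
  MemLp h 2 (μ N T T) ∧
    (∀ F : PhaseSpace N → ℝ, ContDiff ℝ ((⊤ : ℕ∞) : WithTop ℕ∞) F → HasCompactSupport F →
      Tendsto (fun δ : ℝ => ((∫ x, F x ∂(μ N (T + δ / 2) (T - δ / 2))) - ∫ x, F x ∂(μ N T T)) / δ)
        (nhdsWithin 0 {(0 : ℝ)}ᶜ) (nhds (∫ x, F x * h x ∂(μ N T T)))) ∧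
    (∀ i : Fin N, Tendsto (fun δ : ℝ =>
        ((∫ x, (pinnedChain ω₂ lam β γ).bondCurrent N i x ∂(μ N (T + δ / 2) (T - δ / 2))) -
          ∫ x, (pinnedChain ω₂ lam β γ).bondCurrent N i x ∂(μ N T T)) / δ)
        (nhdsWithin 0 {(0 : ℝ)}ᶜ) (nhds (∫ x, (pinnedChain ω₂ lam β γ).bondCurrent N i x * h x ∂(μ N T T))))

/-- The **odd defect** `∫ (h − h∘Θ)² dμ` of a function under momentum reversal `Θ(q,p) = (q,−p)`
(`= 4‖h^odd‖²_{L²(μ)}` when `Θ` preserves `μ`).  For the response density at `(N,T)` it is the `L²`-core of the snapshot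
irreversibility: `KL(μ_δ‖Θ_*μ_δ) = (δ²/2)·oddDefect + o(δ²)`. (object) [this cell] -/
def oddDefect {N : ℕ} (μ : Measure (PhaseSpace N)) (h : PhaseSpace N → ℝ) : ℝ :=
  ∫ x, (h x - h (x.1, -x.2)) ^ 2 ∂μ

/-- `oddDefect_nonneg` (docstring added by the landing lane; see the module docstring). [formal bookkeeping] -/
theorem oddDefect_nonneg {N : ℕ} (μ : Measure (PhaseSpace N)) (h : PhaseSpace N → ℝ) : 0 ≤ oddDefect μ h :=
  integral_nonneg fun _ => sq_nonneg _

/-- The tree's proved `NessUnique` instantiates the uniqueness frame. [folklore] -/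
theorem uniqueNESS_of_nessUnique (hU : NessUnique) {ω₂ lam β γ : ℝ} (hω : 0 < ω₂) (hl : 0 < lam) (hβ : 0 < β)
    (hγ : 0 < γ) : UniqueNESS ω₂ lam β γ :=
  hU ω₂ lam β γ hω hl hβ hγ

/-- Uniqueness holds (tree: `bondHeatUncertainty_nessUnique_holds`). [folklore] -/
theorem uniqueNESS {ω₂ lam β γ : ℝ} (hω : 0 < ω₂) (hl : 0 < lam) (hβ : 0 < β) (hγ : 0 < γ) :
    UniqueNESS ω₂ lam β γ :=
  uniqueNESS_of_nessUnique bondHeatUncertainty_nessUnique_holds hω hl hβ hγ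

/-- A steady-state family exists (tree: `pinnedChain_exists_isSteadyState`; junk off the positive quadrant). [folklore] -/
theorem exists_isSteadyFamily {ω₂ lam β γ : ℝ} (hω : 0 < ω₂) (hl : 0 < lam) (hβ : 0 < β) (hγ : 0 < γ) :
    ∃ μ : (N : ℕ) → ℝ → ℝ → Measure (PhaseSpace N), IsSteadyFamily ω₂ lam β γ μ := by
  classical
  refine ⟨fun N T_L T_R => if h : 0 < T_L ∧ 0 < T_R then
      (pinnedChain_exists_isSteadyState hω hl hβ hγ N h.1 h.2).choose else 0, ?_⟩
  intro N T_L T_R hL hR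
  simp only [dif_pos (And.intro hL hR)]
  exact (pinnedChain_exists_isSteadyState hω hl hβ hγ N hL hR).choose_spec

/-- The tree's proved `ResponseDensity` (stmt-9144) supplies a response density in the frame. [folklore] -/
theorem exists_isResponseDensity_of (hR : ResponseDensity) {ω₂ lam β γ : ℝ} (hω : 0 < ω₂) (hl : 0 < lam)
    (hβ : 0 < β) (hγ : 0 < γ) (hU : UniqueNESS ω₂ lam β γ) {μ : (N : ℕ) → ℝ → ℝ → Measure (PhaseSpace N)}
    (hμ : IsSteadyFamily ω₂ lam β γ μ) {T : ℝ} (hT : 0 < T) (N : ℕ) :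
    ∃ h : PhaseSpace N → ℝ, IsResponseDensity ω₂ lam β γ μ T N h :=
  hR ω₂ lam β γ hω hl hβ hγ hU μ hμ T hT N

/-- Response densities exist (tree: `responseDensity_holds`). [folklore] -/
theorem exists_isResponseDensity {ω₂ lam β γ : ℝ} (hω : 0 < ω₂) (hl : 0 < lam) (hβ : 0 < β) (hγ : 0 < γ)
    (hU : UniqueNESS ω₂ lam β γ) {μ : (N : ℕ) → ℝ → ℝ → Measure (PhaseSpace N)}
    (hμ : IsSteadyFamily ω₂ lam β γ μ) {T : ℝ} (hT : 0 < T) (N : ℕ) :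
    ∃ h : PhaseSpace N → ℝ, IsResponseDensity ω₂ lam β γ μ T N h :=
  exists_isResponseDensity_of responseDensity_holds hω hl hβ hγ hU hμ hT N

/-! ## §2 The pieces -/

/-- **(L) `OvershootParityFloor`** — the fixed-`N` parity floor of the retarded transient: for `N ≥ 2`, every response
density `h` at `(N,T)` and EVERY `t ≥ 0`, `escapeTransient_N(t) ≥ −(T²/(2γ))·∫ (h − h∘Θ)² dμ_{N,T,T}`.
Proof plan (identity (I) + contraction, header): `(T²/γ)·Ov_N(t) = ⟨h₀∘Θ, h₀ − P_t h₀⟩ ≥ ⟨h₀∘Θ,h₀⟩ − ‖h₀‖² = −2‖h₀^odd‖²`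
and `‖h₀^odd‖² = (T⁴/(4γ²))∫(h−h∘Θ)²` by `OddDensityIsCorrector` + the site-`0` balance `h₀^odd = −u_tot^odd/(γ(N−1))`; tree
inputs `pinnedChain_detailedBalance`, `pinnedChain_sq_act_le_of_sq_integrable`, `CorrectorTheory`, `OddDensityIsCorrector`.
Why it might fail: only through a slip in the fixed-`N` bookkeeping (existence/`L²`-membership of the `θ₀`-corrector `h₀` and the
Fubini exchange in (I)) — the inequality itself is certified on the harmonic chain to ratio `1.000000`.
Tags: fixed-N · ATTACKABLE·M. (piece) [route statement · this cell; NOT a literature fact] -/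
def OvershootParityFloor : Prop :=
  ∀ ω₂ lam β γ : ℝ, 0 < ω₂ → 0 < lam → 0 < β → 0 < γ → UniqueNESS ω₂ lam β γ →
    ∀ μ : (N : ℕ) → ℝ → ℝ → Measure (PhaseSpace N), IsSteadyFamily ω₂ lam β γ μ → ∀ T : ℝ, 0 < T →
      ∀ (N : ℕ) (h : PhaseSpace N → ℝ), 2 ≤ N → IsResponseDensity ω₂ lam β γ μ T N h → ∀ t : ℝ, 0 ≤ t →
        -(T ^ 2 / (2 * γ) * oddDefect (μ N T T) h) ≤ escapeTransient ω₂ lam β γ T N t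

/-- **(O_s) `OddSnapshotGrade s`** — the odd-sector ladder: `∃ C N₀, ∀ N ≥ N₀`, every response density `h` at `(N,T)` has
`∫ (h − h∘Θ)² dμ_{N,T,T} ≤ C·N^s` (larger `s` = WEAKER).  `s = 1` is the `L²`-core of the crux (K) (`oddSnapshotGrade_one_of_snapshot`:
(K) ∧ (L₂) ⟹ (O₁)); phonon value `≈ 0.32·N` (TRUE at `s = 1`, FALSE at every `s < 1`); `s = 0` is the «intensive arrow» of route
OddSectorIrreversibility; `s = −1` is the conclusion of the dead `OddResponseBound` (`oddSnapshotGrade_neg_one_of_oddResponseBound`).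
With (L): `(O_s) ⟹ TransientFloor s` (`transientFloor_of_parityFloor_grade`).
Why it might fail (`s = 1`): an odd response sector growing faster than the chain — e.g. a boundary layer of the NESS density whose
`Θ`-odd part does not delocalise — would make `∫(h−h∘Θ)²` superlinear; the same event kills (K) [cite: DechantSasa2018, Eq. 4].
Tags: `s = 1` UNDECIDED · ⟸ (K) · NOT implied by 11071; `s ≤ 0` phonon-FALSE. (piece · ladder) [route statement · this cell; NOT a literature fact] -/
def OddSnapshotGrade (s : ℝ) : Prop :=
  ∀ ω₂ lam β γ : ℝ, 0 < ω₂ → 0 < lam → 0 < β → 0 < γ → UniqueNESS ω₂ lam β γ →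
    ∀ μ : (N : ℕ) → ℝ → ℝ → Measure (PhaseSpace N), IsSteadyFamily ω₂ lam β γ μ → ∀ T : ℝ, 0 < T →
      ∃ C : ℝ, ∃ N₀ : ℕ, ∀ (N : ℕ) (h : PhaseSpace N → ℝ), N₀ ≤ N → IsResponseDensity ω₂ lam β γ μ T N h →
        oddDefect (μ N T T) h ≤ C * (N : ℝ) ^ s

/-- **(L₂) `SnapshotKLLowerExpansion`** — the fixed-`N` lower second-order expansion of the snapshot divergence: if
`KL(μ_δ ‖ Θ_*μ_δ) ≤ B·δ²` for all small `δ ≠ 0` (`μ_δ := μ_{N,T+δ/2,T−δ/2}`, `B ≥ 0`), then `½·∫ (h − h∘Θ)² dμ_{N,T,T} ≤ B` for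
every response density `h` at `(N,T)` (stated for `B ≥ 0` only, so that no positivity of the steady current is presupposed).  Proof plan: Donsker–Varadhan `KL(ν‖ν') ≥ ∫g dν − log ∫e^g dν'` with `g := δ·φ`, `φ` a bounded smooth
compactly supported approximation of `h − h∘Θ`, expanded to second order using the response-density pairings (tree:
`tendsto_oddAsymmetry`), then `φ → h − h∘Θ` in `L²`.
Why it might fail: the second-order expansion of `log ∫ e^{δφ} dΘ_*μ_δ` needs the pairing limits for `φ²` as well as `φ` — both are
smooth compactly supported, so covered by the response-density bracket; failure only by a bookkeeping slip.
Tags: fixed-N · ATTACKABLE·S/M. (piece) [route statement · this cell; NOT a literature fact] -/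
def SnapshotKLLowerExpansion : Prop :=
  ∀ ω₂ lam β γ : ℝ, 0 < ω₂ → 0 < lam → 0 < β → 0 < γ → UniqueNESS ω₂ lam β γ →
    ∀ μ : (N : ℕ) → ℝ → ℝ → Measure (PhaseSpace N), IsSteadyFamily ω₂ lam β γ μ → ∀ T : ℝ, 0 < T →
      ∀ (N : ℕ) (h : PhaseSpace N → ℝ), IsResponseDensity ω₂ lam β γ μ T N h → ∀ B : ℝ, 0 ≤ B →
        (∀ᶠ δ in nhdsWithin (0 : ℝ) {(0 : ℝ)}ᶜ,
          InformationTheory.klDiv (μ N (T + δ / 2) (T - δ / 2))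
              (Measure.map (fun x : PhaseSpace N => (x.1, -x.2)) (μ N (T + δ / 2) (T - δ / 2))) ≤
            ENNReal.ofReal (B * δ ^ 2)) →
        oddDefect (μ N T T) h / 2 ≤ B

/-- **`TransientFloorUniform s`** — the time-UNIFORM floor `∃ C N₀, ∀ N ≥ N₀, ∀ t ≥ 0, Ov_N(t) ≥ −C·N^s`; it implies
`TransientFloor s` for every window `c` (`transientFloor_of_uniform`) and is what the parity floor delivers
(`transientFloorUniform_of_parityFloor_grade`). (piece · ladder) [route statement · this cell; NOT a literature fact] -/
def TransientFloorUniform (s : ℝ) : Prop :=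
  ∀ ω₂ lam β γ : ℝ, 0 < ω₂ → 0 < lam → 0 < β → 0 < γ → ∀ T : ℝ, 0 < T →
    ∃ C : ℝ, ∃ N₀ : ℕ, ∀ N : ℕ, N₀ ≤ N → ∀ t : ℝ, 0 ≤ t →
      -(C * (N : ℝ) ^ s) ≤ escapeTransient ω₂ lam β γ T N t

/-! ## §3 Doors (all PROVED) -/

/-- Time-uniform ⟹ windowed. [folklore] -/
theorem transientFloor_of_uniform {s : ℝ} : TransientFloorUniform s → TransientFloor s := by
  intro hF ω₂ lam β γ hω hl hβ hγ T hT c hc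
  obtain ⟨C, N₀, hC⟩ := hF ω₂ lam β γ hω hl hβ hγ T hT
  exact ⟨C, N₀, fun N hN => hC N hN (c * (N : ℝ) ^ 2) (by positivity)⟩

/-- **(L) ∧ (O_s) ⟹ the time-uniform floor of grade `s`**, relative to response densities and uniqueness supplied as
hypotheses BY NAME (both are proved items of the tree). [folklore] -/
theorem transientFloorUniform_of_parityFloor_grade_of (hR : ResponseDensity) (hUn : NessUnique) {s : ℝ} :
    OvershootParityFloor → OddSnapshotGrade s → TransientFloorUniform s := by
  intro hL hO ω₂ lam β γ hω hl hβ hγ T hT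
  have hU : UniqueNESS ω₂ lam β γ := uniqueNESS_of_nessUnique hUn hω hl hβ hγ
  obtain ⟨μ, hμ⟩ := exists_isSteadyFamily hω hl hβ hγ
  obtain ⟨C, N₀, hC⟩ := hO ω₂ lam β γ hω hl hβ hγ hU μ hμ T hT
  refine ⟨T ^ 2 / (2 * γ) * max C 0, max N₀ 2, fun N hN t ht => ?_⟩
  have hN₀ : N₀ ≤ N := le_trans (le_max_left _ _) hN
  have hN2 : 2 ≤ N := le_trans (le_max_right _ _) hN
  obtain ⟨h, hh⟩ := exists_isResponseDensity_of hR hω hl hβ hγ hU hμ hT N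
  have h1 := hC N h hN₀ hh
  have h2 := hL ω₂ lam β γ hω hl hβ hγ hU μ hμ T hT N h hN2 hh t ht
  have hNs : (0 : ℝ) ≤ (N : ℝ) ^ s := by positivity
  have hc0 : (0 : ℝ) ≤ T ^ 2 / (2 * γ) := by positivity
  have h3 : oddDefect (μ N T T) h ≤ max C 0 * (N : ℝ) ^ s :=
    le_trans h1 (mul_le_mul_of_nonneg_right (le_max_left _ _) hNs)
  have h4 : T ^ 2 / (2 * γ) * oddDefect (μ N T T) h ≤ T ^ 2 / (2 * γ) * (max C 0 * (N : ℝ) ^ s) :=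
    mul_le_mul_of_nonneg_left h3 hc0
  linarith [h4, h2]

/-- **(L) ∧ (O_s) ⟹ `TransientFloorUniform s`** with the frame hypotheses discharged by the tree
(`responseDensity_holds`, `bondHeatUncertainty_nessUnique_holds`). [folklore] -/
theorem transientFloorUniform_of_parityFloor_grade {s : ℝ} :
    OvershootParityFloor → OddSnapshotGrade s → TransientFloorUniform s :=
  transientFloorUniform_of_parityFloor_grade_of responseDensity_holds bondHeatUncertainty_nessUnique_holds

/-- **(L) ∧ (O_s) ⟹ `TransientFloor s`** (every window `c`). [folklore] -/
theorem transientFloor_of_parityFloor_grade {s : ℝ} :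
    OvershootParityFloor → OddSnapshotGrade s → TransientFloor s :=
  fun hL hO => transientFloor_of_uniform (transientFloorUniform_of_parityFloor_grade hL hO)

/-- **(L₂) ∧ (K) ⟹ (O₁)**: the crux `ExtensiveSnapshotIrreversibility` (stmt-9121) is, to second order in `δ`, the linear
odd-defect bound `∫ (h − h∘Θ)² dμ_{N,T,T} ≤ 2C·N`. [folklore] -/
theorem oddSnapshotGrade_one_of_snapshot :
    SnapshotKLLowerExpansion → ExtensiveSnapshotIrreversibility → OddSnapshotGrade 1 := by
  intro hL2 hK ω₂ lam β γ hω hl hβ hγ hU μ hμ T hT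
  obtain ⟨C, hC⟩ := hK ω₂ lam β γ hω hl hβ hγ hU μ hμ T hT
  refine ⟨2 * max C 0, 0, fun N h _ hh => ?_⟩
  have hN : (0 : ℝ) ≤ (N : ℝ) := Nat.cast_nonneg N
  have hB : (0 : ℝ) ≤ max C 0 * (N : ℝ) := mul_nonneg (le_max_right _ _) hN
  have hev : ∀ᶠ δ in nhdsWithin (0 : ℝ) {(0 : ℝ)}ᶜ,
      InformationTheory.klDiv (μ N (T + δ / 2) (T - δ / 2))
          (Measure.map (fun x : PhaseSpace N => (x.1, -x.2)) (μ N (T + δ / 2) (T - δ / 2))) ≤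
        ENNReal.ofReal (max C 0 * (N : ℝ) * δ ^ 2) := by
    filter_upwards [hC N] with δ hδ
    refine le_trans hδ (ENNReal.ofReal_le_ofReal ?_)
    exact mul_le_mul_of_nonneg_right (mul_le_mul_of_nonneg_right (le_max_left _ _) hN) (sq_nonneg δ)
  have h1 : oddDefect (μ N T T) h / 2 ≤ max C 0 * (N : ℝ) :=
    hL2 ω₂ lam β γ hω hl hβ hγ hU μ hμ T hT N h hh (max C 0 * N) hB hev
  rw [Real.rpow_one]
  linarith [h1]

/-- **(K) discharges (F₁)**: `(L) ∧ (L₂) ∧ ExtensiveSnapshotIrreversibility ⟹ TransientFloor 1` (indeed time-uniformly). [folklore] -/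
theorem transientFloor_one_of_snapshot :
    OvershootParityFloor → SnapshotKLLowerExpansion → ExtensiveSnapshotIrreversibility → TransientFloor 1 :=
  fun hL hL2 hK => transientFloor_of_parityFloor_grade hL (oddSnapshotGrade_one_of_snapshot hL2 hK)

/-- **THE DOOR (generation 94): `(D) ∧ (L) ∧ (L₂) ∧ (K) ⟹ BoundedResponse` (stmt-AtomisticToContinuum-11071) BY NAME**, through the
generation-92 door `boundedResponse_of_deficitCesaroPoint_transientFloor`; (L), (L₂) fixed-`N`, (K) = the route's crux stmt-9121,
(D) = `DeficitCesaroPoint`. [folklore] -/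
theorem boundedResponse_of_deficitCesaroPoint_snapshot :
    DeficitCesaroPoint → OvershootParityFloor → SnapshotKLLowerExpansion → ExtensiveSnapshotIrreversibility →
      BoundedResponse :=
  fun hD hL hL2 hK => boundedResponse_of_deficitCesaroPoint_transientFloor hD (transientFloor_one_of_snapshot hL hL2 hK)

/-- The same door in the escape-exponent language: `(D) ∧ (L) ∧ (L₂) ∧ (K) ⟹ OhmicFloor`. [folklore] -/
theorem ohmicFloor_of_deficitCesaroPoint_snapshot :
    DeficitCesaroPoint → OvershootParityFloor → SnapshotKLLowerExpansion → ExtensiveSnapshotIrreversibility → OhmicFloor :=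
  fun hD hL hL2 hK => ohmicFloor_of_deficitCesaroPoint_transientFloor hD (transientFloor_one_of_snapshot hL hL2 hK)

/-- **The graded ladder**: `(L) ∧ (O_s) ∧ (D_h) ⟹ ExponentFloor (2 − max s h)` — e.g. the «intensive arrow» `s = 0` with diffusive
injection `h = 1` gives the Ohmic exponent `1`, and any `s < 2` with the PROVED `D_2` gives nothing (`2 − 2 = 0`), as it must. [folklore] -/
theorem exponentFloor_of_parityFloor_grades {s h : ℝ} :
    OvershootParityFloor → OddSnapshotGrade s → DeficitCesaroGrade h → ExponentFloor (2 - max s h) :=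
  fun hL hO hD => exponentFloor_of_grades hD (transientFloor_of_parityFloor_grade hL hO)

/-- The ladder is monotone: `s ≤ s' ⟹ (O_s ⟹ O_{s'})`. [folklore] -/
theorem oddSnapshotGrade_mono {s s' : ℝ} (hss' : s ≤ s') : OddSnapshotGrade s → OddSnapshotGrade s' := by
  intro hO ω₂ lam β γ hω hl hβ hγ hU μ hμ T hT
  obtain ⟨C, N₀, hC⟩ := hO ω₂ lam β γ hω hl hβ hγ hU μ hμ T hT
  refine ⟨max C 0, max N₀ 1, fun N h hN hh => ?_⟩
  have hN₀ : N₀ ≤ N := le_trans (le_max_left _ _) hN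
  have hN1 : (1 : ℝ) ≤ N := by exact_mod_cast le_trans (le_max_right _ _) hN
  have h1 := hC N h hN₀ hh
  have hNs : (0 : ℝ) ≤ (N : ℝ) ^ s := by positivity
  have hmono : (N : ℝ) ^ s ≤ (N : ℝ) ^ s' := Real.rpow_le_rpow_of_exponent_le hN1 hss'
  calc oddDefect (μ N T T) h ≤ C * (N : ℝ) ^ s := h1
    _ ≤ max C 0 * (N : ℝ) ^ s := mul_le_mul_of_nonneg_right (le_max_left _ _) hNs
    _ ≤ max C 0 * (N : ℝ) ^ s' := mul_le_mul_of_nonneg_left hmono (le_max_right _ _)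

/-- **The dead bottom rung**: the conclusion of `OddResponseBound` (stmt-9140, `N·∫(h−h∘Θ)² ≤ C`; refuted in spirit by
`Negative/EchoFloor.lean`, `≍ N⁰` in the deterministic diffusive class, `≍ N` for phonons) is exactly `O₋₁`.  Recorded so that the
ladder `O₋₁ ⟹ O₀ ⟹ O₁` displays which rungs are dead (`s < 1` for phonons) and which is the crux (`s = 1`). [folklore] -/
theorem oddSnapshotGrade_neg_one_of_oddResponseBound : OddResponseBound → OddSnapshotGrade (-1) := by
  intro hB ω₂ lam β γ hω hl hβ hγ hU μ hμ T hT
  obtain ⟨C, hC⟩ := hB ω₂ lam β γ hω hl hβ hγ hU μ hμ T hT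
  refine ⟨C, 2, fun N h hN hh => ?_⟩
  have h1 := (hC N h hN hh).2
  have hNpos : (0 : ℝ) < N := by exact_mod_cast lt_of_lt_of_le (by norm_num : 0 < 2) hN
  rw [Real.rpow_neg_one, ← div_eq_mul_inv, le_div_iff₀ hNpos]
  simpa [oddDefect, mul_comm] using h1

/-- **The pointwise budget** behind the door: under (L), for `N ≥ 2`, every response density `h` and every `t ≥ 0`,
`t·E_N ≤ W_N(t) + (T²/(2γ))·∫ (h − h∘Θ)² dμ_{N,T,T}` (`W_N = deficitCesaro`, `E_N = escapeDeficit`; from the tree's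
`W_N(t) = t·E_N + Ov_N(t)`).  With `t = cN²`: `E_N ≤ W_N(cN²)/(cN²) + (T²/(2γc))·oddDefect/N²`. [folklore] -/
theorem mul_escapeDeficit_le_deficitCesaro_add_oddDefect (hL : OvershootParityFloor) {ω₂ lam β γ : ℝ} (hω : 0 < ω₂)
    (hl : 0 < lam) (hβ : 0 < β) (hγ : 0 < γ) (hU : UniqueNESS ω₂ lam β γ)
    {μ : (N : ℕ) → ℝ → ℝ → Measure (PhaseSpace N)} (hμ : IsSteadyFamily ω₂ lam β γ μ) {T : ℝ} (hT : 0 < T)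
    {N : ℕ} (hN : 2 ≤ N) {h : PhaseSpace N → ℝ} (hh : IsResponseDensity ω₂ lam β γ μ T N h) {t : ℝ} (ht : 0 ≤ t) :
    t * escapeDeficit ω₂ lam β γ T N ≤ deficitCesaro ω₂ lam β γ T N t + T ^ 2 / (2 * γ) * oddDefect (μ N T T) h := by
  have hid := deficitCesaro_eq_add hω hl hβ hγ hT N ht
  have hfl := hL ω₂ lam β γ hω hl hβ hγ hU μ hμ T hT N h hN hh t ht
  linarith [hid, hfl]

end Summit.AtomisticToContinuum.FouriersLaw.Theorems.BoundedResponse.ParityFloor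

end
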